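import Mathlib
import HarnessLib
import Summits.HubbardSuperconductivity.HubbardSuperconductivity.Theorems.KLProgrammeKLRegimeEngineTowerLevNumericsPackageZNG

/-!
# Route `KLProgramme` — crux K3 ENGINE (stmt-HubbardSuperconductivity-20437 `KLRegimeEngineV17F2`), stub (b) v2, THE WEIGHTED HALF «(b)-WT4», numerics side
# (cell gate-hubbard-kl, seat p4 g22): BLOCK 0's PLAIN Z-THREAD GUARD OF THE WEIGHTED ASSEMBLY, DISCHARGED — the adapter from `levNumerics_packageZNG` (iv)
# to the binder shapes of k3c3-p2's final weighted assembly (W14 `kernelNormsWt4_all_klEng_final` and its ♯2/♯3 re-keys)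

The final weighted assembly asks, for block 0's Z-thread (p3 `towerZ_blockZero_klEng`; names `κz αz crz ccz` with constants `Cκz Cbz CJz`, the law names
inline), a majorant array `νz` of the PLAIN level-0 datum `(A₁′, P₁′, T₁′)` at `λ_1` — `27⁵(T₁′(|U| + c)/ε_x) ≤ νz 1`, `27⁵(A₁′P₁′²|U|/ε_x³) ≤ νz 2`,
`27⁵(A₁′ε_x/Klam²/B²)(λ_1)^{m−1}(P₁′/ε_x²)^m ≤ νz m` (`m ≥ 3`) — and the PLAIN kit guard
`9αz·ccz/(27⁵e·κz²·crz) · towerV D (e²κz²/ccz²) (m ↦ 64·27⁴e²crz/ccz·(e⁴ccz²ε_x²/8)^m·νz m) < 1`.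
**`levNum_zguard`** serves it from `levNumerics_packageZNG` (iv) with the CHOICE `νz m := [the two sizes, 27⁵·Ab′·λ^{m−1}·Qb′^m]`, at any coupling `λ` with
`Bf·Klam·U ≤ λ ≤ ufz`, under the (U, c)-DOOR **`U, c ≤ ugz := 1/(4·27⁵·W₀₀Z₀₀·T₁′·Bf + 1)`** (`W₀₀ = 32·27⁴e²`, `Z₀₀ = e⁴(81CJz)²/8`) and `U ≤ 1`, `Bf`
above ZNG's threshold; closed forms `ab₀ = A₁′/(2Klam²)`, `qb₀ = 4P₁′`, `i₂₀ = 8·27⁵W₀₀Z₀₀²A₁′P₁′²/Klam` + those of `levNumerics_packageZNG`.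
Pure real arithmetic; nothing about the model is asserted; nothing asserts (b), WT4, any stub, K3 or superconductivity.
References: BGM 2006 §2.8 (2.83)–(2.84), (2.93)–(2.98), Lemma 2.5 (2.98) [cite: BenfattoGiulianiMastropietro2006].
-/

noncomputable section

namespace Summit.HubbardSuperconductivity.HubbardSuperconductivity.Theorems.EngineV8

set_option linter.dupNamespace false -- summit = problem name (single-conjunct summit), D-0017

open Real Literature.MathematicalPhysics.QuantumLattice
open Summit.HubbardSuperconductivity.HubbardSuperconductivity.Theorems.KLRegimeSplit

set_option maxHeartbeats 1600000 in -- one ~40-binder statement over `levNumerics_packageZNG`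
/-- **BLOCK 0's PLAIN Z-THREAD GUARD OF THE WEIGHTED ASSEMBLY, DISCHARGED** (majorant array chosen, its three rows, the plain kit guard at every degree cap; see the
module docstring). [cite: BenfattoGiulianiMastropietro2006, §2.8 (2.83)-(2.84), (2.93)-(2.98), Lemma 2.5 (2.98)] -/
theorem levNum_zguard
    {Cκz Cbz CJz A₁' P₁' T₁' Klam : ℝ} {d : ℕ}
    (hCκz : 0 < Cκz) (hCbz : 0 < Cbz) (hCJz : 0 < CJz) (hA₁' : 0 < A₁') (hP₁' : 0 < P₁') (hT₁' : 0 < T₁') (hKlam : 1 ≤ Klam)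
    -- the r-free closed forms (instantiate with `rfl`)
    {ab₀ qb₀ i₂₀ W₀₀ Z₀₀ s₀₀ t₀₀ p₀₀ φ₀₀ QL₀ QH₀ aP₀ sC₀ Θ₀ ufz aT₀ aT₁ qT₀ qT₁ CEf₀ ugz : ℝ} {Bf : ℝ}
    (hab₀ : ab₀ = A₁' / (2 * Klam ^ 2)) (hqb₀ : qb₀ = 4 * P₁')
    (hW₀₀ : W₀₀ = 32 * (27 : ℝ) ^ 4 * exp 2) (hZ₀₀ : Z₀₀ = exp 4 * (81 * CJz) ^ 2 / 8) (hi₂₀ : i₂₀ = 8 * (27 : ℝ) ^ 5 * W₀₀ * Z₀₀ ^ 2 * A₁' * P₁' ^ 2 / Klam)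
    (hs₀₀ : s₀₀ = 2 * Cκz * klE0 / (exp 4 * 162 ^ 2 * CJz ^ 2)) (ht₀₀ : t₀₀ = exp 2 * (2 * Cκz * klE0) / (162 ^ 2 * CJz ^ 2))
    (hp₀₀ : p₀₀ = exp 4 * 162 ^ 2 * CJz ^ 2 / (2 * Cκz * klE0)) (hφ₀₀ : φ₀₀ = 9 * Cbz * (4 : ℝ) ^ d / ((27 : ℝ) ^ 5 * exp 1 * Cκz * klE0 ^ 2))
    (hQL₀ : QL₀ = Z₀₀ * qb₀) (hQH₀ : QH₀ = Z₀₀ * qb₀ + 1) (haP₀ : aP₀ = (27 : ℝ) ^ 5 * W₀₀ * ab₀)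
    (hsC₀ : sC₀ = i₂₀ / (2 * QL₀) + aP₀ * QH₀ ^ 3 / (4 * QL₀ ^ 2) + aP₀ * QH₀ / 4)
    (hΘ₀ : Θ₀ = exp 1 ^ 2 * φ₀₀ * t₀₀ ^ 2 * i₂₀ + exp 1 ^ 3 * φ₀₀ * t₀₀ ^ 3 * (aP₀ * QH₀ ^ 3) + exp 1 ^ 3 * φ₀₀ * t₀₀ ^ 3 * aP₀ * QH₀ ^ 3)
    (hufz : ufz = min 1 (min (1 / (8 * s₀₀ * QH₀ + 1)) (min (1 / (2 * exp 1 * t₀₀ * QH₀ + 1)) (1 / (4 * Θ₀ + 1)))))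
    (haT₀ : aT₀ = 1 * (ab₀ + aP₀ + exp 1 * φ₀₀ * t₀₀ * (1 + sC₀) ^ 2 / QL₀))
    (haT₁ : aT₁ = 1 * (ab₀ + aP₀ + exp 1 * φ₀₀ * t₀₀ * (1 + sC₀) ^ 2 / QL₀))
    (hqT₀ : qT₀ = 1 * (1 + 1 * qb₀ + 4 * QH₀ + 2 * t₀₀ * p₀₀ * QH₀) / 4)
    (hqT₁ : qT₁ = 1 * (1 + 1 * qb₀ + 4 * QH₀ + 2 * t₀₀ * p₀₀ * QH₀))
    (hCEf₀ : CEf₀ = qT₀ * Bf * max 1 (2 * aT₀)) (hugz : ugz = 1 / (4 * (27 : ℝ) ^ 5 * W₀₀ * Z₀₀ * T₁' * Bf + 1))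
    (hBf1 : 1 ≤ Bf) (hBf₀ : 4 * exp 1 * φ₀₀ * t₀₀ * (1 + sC₀) ≤ Bf) :
    0 < ufz ∧ 0 < ugz ∧
    ∀ (β : ℝ) (M : ℕ) [NeZero M], 0 < β → β ≤ M → ∀ (U c : ℝ), 0 < U → U ≤ 1 → 0 < c → U ≤ ugz → c ≤ ugz →
    -- the Z-thread names (equational, W14's order)
    ∀ (κz αz crz ccz : ℝ), κz = Real.sqrt (2 * Cκz * klE0) → αz = Cbz * ((M : ℝ) / β) * (4 : ℝ) ^ d / klE0 →
      crz = 81 * CJz * M / β → ccz = 162 * CJz * M / β →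
    -- the coupling `λ` (= `λ_1` in the assembly)
    ∀ lam : ℝ, Bf * Klam * U ≤ lam → lam ≤ ufz →
    -- the majorant array (the choice) ⊢ its three rows and the plain kit guard at every degree cap
    ∀ νz : ℕ → ℝ, νz = (fun m => if m = 1 then (27 : ℝ) ^ 5 * (T₁' * (|U| + c) / imagTimeWeight β M)
        else if m = 2 then (27 : ℝ) ^ 5 * (A₁' * P₁' ^ 2 * |U| / imagTimeWeight β M ^ 3)
        else (27 : ℝ) ^ 5 * (A₁' * imagTimeWeight β M / Klam ^ 2 / Bf ^ 2) * lam ^ (m - 1) * (P₁' / imagTimeWeight β M ^ 2) ^ m) →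
    (27 : ℝ) ^ 5 * (T₁' * (|U| + c) / imagTimeWeight β M) ≤ νz 1 ∧ (27 : ℝ) ^ 5 * (A₁' * P₁' ^ 2 * |U| / imagTimeWeight β M ^ 3) ≤ νz 2 ∧
    (∀ m, 3 ≤ m → (27 : ℝ) ^ 5 * (A₁' * imagTimeWeight β M / Klam ^ 2 / Bf ^ 2) * lam ^ (m - 1) * (P₁' / imagTimeWeight β M ^ 2) ^ m ≤ νz m) ∧
    ∀ D : ℕ, 9 * αz * ccz / ((27 : ℝ) ^ 5 * exp 1 * κz ^ 2 * crz) *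
      towerV D (exp 2 * κz ^ 2 / ccz ^ 2) (fun m => 64 * (27 : ℝ) ^ 4 * exp 2 * crz / ccz * (exp 4 * ccz ^ 2 * imagTimeWeight β M ^ 2 / 8) ^ m * νz m) < 1 := by
  -- §0 constants
  have he0 : (0 : ℝ) < klE0 := by norm_num [klE0]
  have hKlam0 : 0 < Klam := lt_of_lt_of_le one_pos hKlam
  have hab₀0 : 0 < ab₀ := by rw [hab₀]; positivity
  have hqb₀0 : 0 < qb₀ := by rw [hqb₀]; positivity
  have hW₀₀0 : 0 < W₀₀ := by rw [hW₀₀]; positivity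
  have hZ₀₀0 : 0 < Z₀₀ := by rw [hZ₀₀]; positivity
  have hi₂₀0 : 0 ≤ i₂₀ := by rw [hi₂₀]; positivity
  have hBf0 : 0 < Bf := lt_of_lt_of_le one_pos hBf1
  have hugz0 : 0 < ugz := by rw [hugz]; positivity
  obtain ⟨hufz0, -, -, -, hZ⟩ := levNumerics_packageZNG (Cinc₀ := 1) (Dinc₀ := 1) (Cinc₁ := 1) (Dinc₁ := 1) one_pos le_rfl le_rfl le_rfl hCκz hCbz hCJz
    hab₀0 hqb₀0 hi₂₀0 hW₀₀ hZ₀₀ hs₀₀ ht₀₀ hp₀₀ hφ₀₀ hQL₀ hQH₀ haP₀ hsC₀ hΘ₀ hufz haT₀ haT₁ hqT₀ hqT₁ hCEf₀ hBf1 hBf₀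
  refine ⟨hufz0, hugz0, ?_⟩
  intro β M _ hβ hβM U c hU hU1 hc hUug hcug κz αz crz ccz hκz hαz hcrz hccz lam hlam hlamuf νz hνz
  have hM0 : (0 : ℝ) < M := Nat.cast_pos.2 (Nat.pos_of_ne_zero (NeZero.ne M))
  have hβ0 : β ≠ 0 := hβ.ne'
  have hMne : (M : ℝ) ≠ 0 := hM0.ne'
  set r : ℝ := β / M with hr
  have hr0 : 0 < r := by positivity
  have hMβ : (M : ℝ) / β = 1 / r := by rw [hr]; field_simp
  have hitw : imagTimeWeight β M = r / 2 := by rw [imagTimeWeight, hr]; field_simp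
  have habsU : |U| = U := abs_of_pos hU
  have hlam0 : 0 < lam := lt_of_lt_of_le (by positivity) hlam
  -- the law names of the Z-thread, and the pins `W₀ = W₀₀`, `Z₀ = Z₀₀`
  set W₀ : ℝ := 64 * (27 : ℝ) ^ 4 * exp 2 * crz / ccz with hW₀
  set Z₀ : ℝ := exp 4 * ccz ^ 2 * imagTimeWeight β M ^ 2 / 8 with hZ₀
  have hCJz0 : CJz ≠ 0 := hCJz.ne'
  have hW₀' : W₀ = W₀₀ := by rw [hW₀, hW₀₀, hcrz, hccz]; field_simp; norm_num
  have hZ₀' : Z₀ = Z₀₀ := by rw [hZ₀, hZ₀₀, hccz, hitw, hr]; field_simp; ring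
  have hW₀0 : 0 < W₀ := by rw [hW₀']; exact hW₀₀0
  have hZ₀0 : 0 < Z₀ := by rw [hZ₀']; exact hZ₀₀0
  -- the datum in ZNG's currency
  set Ab₀ : ℝ := A₁' * imagTimeWeight β M / Klam ^ 2 / Bf ^ 2 with hAb₀
  set Qb₀ : ℝ := P₁' / imagTimeWeight β M ^ 2 with hQb₀
  have hAb₀' : Ab₀ = ab₀ * (β / M) / Bf ^ 2 := by rw [hAb₀, hitw, hab₀, hr]; field_simp
  have hQb₀' : Qb₀ = qb₀ * ((M : ℝ) / β) ^ 2 := by rw [hQb₀, hitw, hqb₀, hMβ]; field_simp; ring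
  have hAb₀0 : 0 ≤ Ab₀ := by rw [hAb₀']; positivity
  have hQb₀0 : 0 ≤ Qb₀ := by rw [hQb₀']; positivity
  -- the sizes and the slots
  have htwo0 : 0 ≤ (27 : ℝ) ^ 5 * (T₁' * (|U| + c) / imagTimeWeight β M) := by rw [habsU, hitw]; positivity
  have hfour0 : 0 ≤ (27 : ℝ) ^ 5 * (A₁' * P₁' ^ 2 * |U| / imagTimeWeight β M ^ 3) := by rw [habsU, hitw]; positivity
  set ι₁₀ : ℝ := W₀ * Z₀ * ((27 : ℝ) ^ 5 * (T₁' * (|U| + c) / imagTimeWeight β M)) / lam with hι₁₀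
  set ι₂₀ : ℝ := W₀ * Z₀ ^ 2 * ((27 : ℝ) ^ 5 * (A₁' * P₁' ^ 2 * |U| / imagTimeWeight β M ^ 3)) / lam with hι₂₀
  have hι₁₀0 : 0 ≤ ι₁₀ := by rw [hι₁₀]; positivity
  have hι₂₀0 : 0 ≤ ι₂₀ := by rw [hι₂₀]; positivity
  have hι₂₀le : ι₂₀ ≤ i₂₀ * ((M : ℝ) / β) ^ 3 / Bf := by
    have h1 : U / lam ≤ 1 / (Bf * Klam) := by
      rw [div_le_div_iff₀ hlam0 (by positivity), one_mul]; linarith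
    have heq : ι₂₀ = 8 * (27 : ℝ) ^ 5 * W₀₀ * Z₀₀ ^ 2 * A₁' * P₁' ^ 2 / r ^ 3 * (U / lam) := by
      rw [hι₂₀, hW₀', hZ₀', habsU, hitw]; field_simp; ring
    have heq' : i₂₀ * ((M : ℝ) / β) ^ 3 / Bf = 8 * (27 : ℝ) ^ 5 * W₀₀ * Z₀₀ ^ 2 * A₁' * P₁' ^ 2 / r ^ 3 * (1 / (Bf * Klam)) := by
      rw [hi₂₀, hMβ]; field_simp
    rw [heq, heq']; exact mul_le_mul_of_nonneg_left h1 (by positivity)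
  have hprodeq : ι₁₀ * lam = 2 * (27 : ℝ) ^ 5 * W₀₀ * Z₀₀ * T₁' * (U + c) / r := by
    rw [hι₁₀, hW₀', hZ₀', habsU, hitw]; field_simp
  have hprod : ι₁₀ * lam ≤ ((M : ℝ) / β) / Bf := by
    have hUc : U + c ≤ 2 * ugz := by linarith
    have h2 : 2 * (27 : ℝ) ^ 5 * W₀₀ * Z₀₀ * T₁' * (U + c) * Bf ≤ 1 := by
      have h3 : 2 * (27 : ℝ) ^ 5 * W₀₀ * Z₀₀ * T₁' * (U + c) * Bf ≤ 2 * (27 : ℝ) ^ 5 * W₀₀ * Z₀₀ * T₁' * (2 * ugz) * Bf := by gcongr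
      have h4 : 2 * (27 : ℝ) ^ 5 * W₀₀ * Z₀₀ * T₁' * (2 * ugz) * Bf =
          4 * (27 : ℝ) ^ 5 * W₀₀ * Z₀₀ * T₁' * Bf / (4 * (27 : ℝ) ^ 5 * W₀₀ * Z₀₀ * T₁' * Bf + 1) := by
        rw [hugz]; field_simp; norm_num
      have h5 : 4 * (27 : ℝ) ^ 5 * W₀₀ * Z₀₀ * T₁' * Bf / (4 * (27 : ℝ) ^ 5 * W₀₀ * Z₀₀ * T₁' * Bf + 1) ≤ 1 := by
        rw [div_le_one (by positivity)]; linarith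
      linarith
    rw [hMβ, hprodeq]
    calc 2 * (27 : ℝ) ^ 5 * W₀₀ * Z₀₀ * T₁' * (U + c) / r = 2 * (27 : ℝ) ^ 5 * W₀₀ * Z₀₀ * T₁' * (U + c) * Bf / (r * Bf) := by field_simp
      _ ≤ 1 / (r * Bf) := div_le_div_of_nonneg_right h2 (by positivity)
      _ = 1 / r / Bf := by rw [div_div]
  -- ZNG (iv) at the Z-thread
  have hZ' := hZ β M hβ hβM Ab₀ Qb₀ ι₂₀ hAb₀' hQb₀' hι₂₀0 hι₂₀le κz αz crz ccz hκz hαz hcrz hccz W₀ Z₀ (κz ^ 2 / (exp 4 * ccz ^ 2))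
    (9 * αz * ccz / ((27 : ℝ) ^ 5 * exp 1 * κz ^ 2 * crz)) (exp 4 * ccz ^ 2 / κz ^ 2) (exp 2 * κz ^ 2 / ccz ^ 2) hW₀ hZ₀ rfl rfl rfl rfl
    ((27 : ℝ) ^ 5 * W₀ * Ab₀) (Z₀ * Qb₀ + 1) ((27 : ℝ) ^ 5 * W₀ * Ab₀ * (Z₀ * Qb₀ + 1) ^ 3) rfl rfl rfl
  obtain ⟨⟨_, _, hA'0, hQ'0, hZQ, _, hZQ3, _, _, _, _⟩, -, -, -, hguard⟩ := hZ'
  -- the array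
  have hν1 : νz 1 = (27 : ℝ) ^ 5 * (T₁' * (|U| + c) / imagTimeWeight β M) := by rw [hνz]; simp
  have hν2 : νz 2 = (27 : ℝ) ^ 5 * (A₁' * P₁' ^ 2 * |U| / imagTimeWeight β M ^ 3) := by rw [hνz]; simp
  have hνm : ∀ m, 3 ≤ m → νz m = (27 : ℝ) ^ 5 * Ab₀ * lam ^ (m - 1) * Qb₀ ^ m := by
    intro m hm; rw [hνz]; simp only; rw [if_neg (by omega), if_neg (by omega)]
  refine ⟨le_of_eq hν1.symm, le_of_eq hν2.symm, fun m hm => le_of_eq (hνm m hm).symm, fun D => ?_⟩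
  have hν0 : ∀ m, 0 ≤ νz m := by
    intro m
    rcases Nat.lt_or_ge m 3 with h | h
    · interval_cases m
      · rw [hνz]; simp only; rw [if_neg (by omega), if_neg (by omega)]; positivity
      · rw [hν1]; exact htwo0
      · rw [hν2]; exact hfour0
    · rw [hνm m h]; positivity
  have hμ0 : ∀ m, 0 ≤ W₀ * Z₀ ^ m * νz m := fun m => by have := hν0 m; positivity
  refine hguard lam ι₁₀ hlam0.le hlamuf hι₁₀0 hprod D (fun m => W₀ * Z₀ ^ m * νz m) hμ0 ?_ ?_ ?_ ?_
  · show W₀ * Z₀ ^ 1 * νz 1 ≤ ι₁₀ * lam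
    rw [hν1, hι₁₀]; exact le_of_eq (by field_simp)
  · show W₀ * Z₀ ^ 2 * νz 2 ≤ ι₂₀ * lam
    rw [hν2, hι₂₀]; exact le_of_eq (by field_simp)
  · show W₀ * Z₀ ^ 3 * νz 3 ≤ (27 : ℝ) ^ 5 * W₀ * Ab₀ * (Z₀ * Qb₀ + 1) ^ 3 * lam ^ 2
    rw [hνm 3 le_rfl]
    calc W₀ * Z₀ ^ 3 * ((27 : ℝ) ^ 5 * Ab₀ * lam ^ (3 - 1) * Qb₀ ^ 3) = (27 : ℝ) ^ 5 * W₀ * Ab₀ * (Z₀ ^ 3 * Qb₀ ^ 3) * lam ^ 2 := by ring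
      _ ≤ (27 : ℝ) ^ 5 * W₀ * Ab₀ * (Z₀ * Qb₀ + 1) ^ 3 * lam ^ 2 := by gcongr
  · intro m hm4 _
    show W₀ * Z₀ ^ m * νz m ≤ (27 : ℝ) ^ 5 * W₀ * Ab₀ * lam ^ (m - 1) * (Z₀ * Qb₀ + 1) ^ m
    rw [hνm m (by omega)]
    have hZQm : (Z₀ * Qb₀) ^ m ≤ (Z₀ * Qb₀ + 1) ^ m := pow_le_pow_left₀ (by positivity) hZQ m
    calc W₀ * Z₀ ^ m * ((27 : ℝ) ^ 5 * Ab₀ * lam ^ (m - 1) * Qb₀ ^ m) = (27 : ℝ) ^ 5 * W₀ * Ab₀ * lam ^ (m - 1) * (Z₀ * Qb₀) ^ m := by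
          rw [mul_pow]; ring
      _ ≤ (27 : ℝ) ^ 5 * W₀ * Ab₀ * lam ^ (m - 1) * (Z₀ * Qb₀ + 1) ^ m := mul_le_mul_of_nonneg_left hZQm (by positivity)

end Summit.HubbardSuperconductivity.HubbardSuperconductivity.Theorems.EngineV8

end
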